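import Mathlib
import Literature.Analysis.FluidPDE.Vorticity
import Literature.Analysis.FluidPDE.PoincareBall
import Summits.NavierStokesRegularity.NavierStokesRegularity.Theorems.ScaledTopAlignmentDirectionGradientSelection
import HarnessLib

/-!
# Route `ScaledTopAlignment`: tools for the `L^a(L^b)` direction-gradient criterion (Giga–Miura 2011,
# Rmk. 2.8: the scaling-invariant family `2/a + 3/b = 1`) — slice selection under an integrable
# majorant, smoothness of the vorticity direction, and the dilation inequality for ball integrals
# (support for the deciding crux W3ᵐᵗ = `AprioriMostTimesBulkAlignment`, stmt-NavierStokesRegularity-19551;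
# no import of the route file)

Giga–Miura 2011 (HUPS #956 p. 10, after Cor. 2.6 / Rmk. 2.8): "It is easy to generalize our
assumption in this form with `2/a + 3/b = 1` and `2 ≤ a < ∞`", i.e. Type I +
`∇ζ ∈ L^a(−1, 0; L^b(Ω_d(t)))` excludes blow-up. Under the Type-I zoom `t = T + λ_j² s/ν`,
`y ↦ x_j + λ_j y`, the `L^b` norm of the gradient of the zoomed direction field over a unit-scale ball
is `≤ λ_j^{1−3/b} ‖∇ξ(t)‖_{L^b(Ω_d(t))}`, and scaling invariance (`a(1 − 3/b) = 2`) turns the `a`-th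
power of this bound, integrated in slice time, into a tail of the finite integral
`∫_{(0,T)} ‖∇ξ(t)‖^a_{L^b(Ω_d(t))} dt`. This module supplies the three exponent-free tools the
discharge (`ScaledTopAlignmentGigaMiuraDirectionGradientLaLb`) needs:

* `exists_slice_frequently_lt_of_integrable` — for measurable `Φ ≥ 0` with `∫_{(0,T)} Φ < ∞`,
  scales `λ_j → 0⁺` and `a < b < 0`, some slice `s₀ ∈ (a, b)` has `λ_j² Φ(T + λ_j² s₀/ν) < ε`
  frequently in `j`, for every `ε > 0` (affine substitution, absolute continuity of the integral,
  Fatou) — the exponent-free form of `exists_slice_frequently_lt_of_sqIntegrable`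
  (`ScaledTopAlignmentDirectionGradientSelection`, `Φ = g²`);
* `contDiffAt_vorticityDirection` — `ξ = ω/|ω|` is `Cⁿ` at points where `ω` is `Cⁿ` and non-zero;
* `setLIntegral_ball_comp_add_smul_le` — `∫_{B(y₀,r)} Φ(v + c y) dy ≤ c⁻³ ∫_S Φ` whenever the
  dilated ball `v + c B(y₀, r)` lies in `S` (`ℝ³`, `c > 0`).
WHAT THIS IS NOT: not NS regularity; measure theory and calculus only.

## References
* Y. Giga, H. Miura, Comm. Math. Phys. 303 (2011) 289–300 = HUPS #956: Cor. 2.6, Rmk. 2.7–2.8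
  (pp. 9–10). [GigaMiura2011]
-/

noncomputable section

-- the summit and its single sub-problem share the name (CONVENTIONS §1), as in every Theorems file
set_option linter.dupNamespace false

open MeasureTheory Set Function Filter Topology Metric
open scoped RealInnerProductSpace ENNReal NNReal

namespace Summit.NavierStokesRegularity.NavierStokesRegularity.Theorems

open Literature.Analysis Literature.Analysis.FluidPDE

/-! ### Slice selection under an integrable-in-time majorant -/

/-- **Selection of an a.e. slice (exponent-free form).** Let `Φ : ℝ → [0, ∞]` be measurable with
`∫_{(0,T)} Φ < ∞` (`T > 0`, `ν > 0`), let `λ_j > 0`, `λ_j → 0`, and let `a < b < 0`. Then some slice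
`s₀ ∈ (a, b)` has `λ_j² Φ(T + λ_j² s₀/ν) < ε` frequently in `j`, for every `ε > 0`: by the affine
substitution `t = T + λ_j² s/ν`, `∫_{(a,b)} λ_j² Φ(T + λ_j² s/ν) ds = ν ∫_{(T + λ_j² a/ν, T + λ_j² b/ν)} Φ → 0`
(absolute continuity of the finite integral, `tendsto_setLIntegral_zero`), so
`liminf_j λ_j² Φ(T + λ_j² s/ν) = 0` for a.e. `s ∈ (a, b)` by Fatou (`lintegral_liminf_le'`). [folklore] -/
theorem exists_slice_frequently_lt_of_integrable {ν T : ℝ} (hν : 0 < ν) (hT : 0 < T)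
    {Φ : ℝ → ℝ≥0∞} (hΦm : Measurable Φ) (hΦ : (∫⁻ t in Ioo 0 T, Φ t) < ∞)
    {lam : ℕ → ℝ} (hlam : ∀ j, 0 < lam j) (hlam0 : Tendsto lam atTop (𝓝 0))
    {a b : ℝ} (hab : a < b) (hb : b < 0) :
    ∃ s₀ ∈ Ioo a b, ∀ ε : ℝ≥0∞, 0 < ε → ∃ᶠ j in atTop,
      ENNReal.ofReal (lam j) ^ 2 * Φ (T + lam j ^ 2 / ν * s₀) < ε := by
  have hc : ∀ j, 0 < lam j ^ 2 / ν := fun j => div_pos (pow_pos (hlam j) 2) hν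
  have hc0 : Tendsto (fun j => lam j ^ 2 / ν) atTop (𝓝 0) := by
    have h := (hlam0.pow 2).div_const ν
    rw [zero_pow two_ne_zero, zero_div] at h
    exact h
  set H : ℕ → ℝ → ℝ≥0∞ := fun j s => ENNReal.ofReal (lam j) ^ 2 * Φ (T + lam j ^ 2 / ν * s)
    with hHdef
  have hΦc : ∀ j, Measurable fun s : ℝ => Φ (T + lam j ^ 2 / ν * s) := fun j =>
    hΦm.comp ((measurable_id.const_mul (lam j ^ 2 / ν)).const_add T)
  have hHm : ∀ j, Measurable (H j) := fun j => (hΦc j).const_mul _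
  -- the change of variables
  have hInt : ∀ j, ∫⁻ s in Ioo a b, H j s =
      ENNReal.ofReal ν * ∫⁻ t in Ioo (T + lam j ^ 2 / ν * a) (T + lam j ^ 2 / ν * b), Φ t := by
    intro j
    have h3 : ∫⁻ s in Ioo a b, Φ (T + lam j ^ 2 / ν * s) = ENNReal.ofReal (lam j ^ 2 / ν)⁻¹ *
        ∫⁻ t in Ioo (T + lam j ^ 2 / ν * a) (T + lam j ^ 2 / ν * b), Φ t :=
      setLIntegral_Ioo_comp_add_mul (hc j) T a b Φ
    have e2 : ENNReal.ofReal (lam j) ^ 2 * ENNReal.ofReal (lam j ^ 2 / ν)⁻¹ = ENNReal.ofReal ν := by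
      rw [← ENNReal.ofReal_pow (hlam j).le, ← ENNReal.ofReal_mul (pow_nonneg (hlam j).le 2)]
      congr 1
      have hl : lam j ^ 2 ≠ 0 := pow_ne_zero 2 (hlam j).ne'
      rw [div_eq_mul_inv, mul_inv, inv_inv, ← mul_assoc, mul_inv_cancel₀ hl, one_mul]
    simp only [hHdef]
    rw [lintegral_const_mul _ (hΦc j), h3, ← mul_assoc, e2]
  -- the physical windows shrink into `(0, T)` and their length tends to zero
  have hsub : ∀ᶠ j in atTop, Ioo (T + lam j ^ 2 / ν * a) (T + lam j ^ 2 / ν * b) ⊆ Ioo 0 T := by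
    have h1 : Tendsto (fun j => lam j ^ 2 / ν * (-a)) atTop (𝓝 (0 * (-a))) := hc0.mul_const _
    rw [zero_mul] at h1
    filter_upwards [h1.eventually_lt_const hT] with j hj
    intro t ht
    have hb' : lam j ^ 2 / ν * b < 0 := mul_neg_of_pos_of_neg (hc j) hb
    exact ⟨by linarith [ht.1], by linarith [ht.2]⟩
  have hvol : Tendsto (fun j => (volume.restrict (Ioo 0 T))
      (Ioo (T + lam j ^ 2 / ν * a) (T + lam j ^ 2 / ν * b))) atTop (𝓝 0) := by
    have h1 : Tendsto (fun j => ENNReal.ofReal (lam j ^ 2 / ν * (b - a))) atTop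
        (𝓝 (ENNReal.ofReal (0 * (b - a)))) := ENNReal.tendsto_ofReal (hc0.mul_const _)
    rw [zero_mul, ENNReal.ofReal_zero] at h1
    refine tendsto_of_tendsto_of_tendsto_of_le_of_le tendsto_const_nhds h1 (fun _ => zero_le)
      fun j => ?_
    calc (volume.restrict (Ioo 0 T)) (Ioo (T + lam j ^ 2 / ν * a) (T + lam j ^ 2 / ν * b))
        ≤ volume (Ioo (T + lam j ^ 2 / ν * a) (T + lam j ^ 2 / ν * b)) :=
          Measure.le_iff'.1 Measure.restrict_le_self _
      _ = ENNReal.ofReal (lam j ^ 2 / ν * (b - a)) := by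
          rw [Real.volume_Ioo]; ring_nf
  have htail : Tendsto (fun j => ∫⁻ t in Ioo (T + lam j ^ 2 / ν * a) (T + lam j ^ 2 / ν * b),
      Φ t ∂(volume.restrict (Ioo 0 T))) atTop (𝓝 0) :=
    tendsto_setLIntegral_zero (μ := volume.restrict (Ioo 0 T))
      (s := fun j => Ioo (T + lam j ^ 2 / ν * a) (T + lam j ^ 2 / ν * b)) hΦ.ne hvol
  have hL1 : Tendsto (fun j => ∫⁻ s in Ioo a b, H j s) atTop (𝓝 0) := by
    have h1 : Tendsto (fun j => ENNReal.ofReal ν *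
        ∫⁻ t in Ioo (T + lam j ^ 2 / ν * a) (T + lam j ^ 2 / ν * b),
          Φ t ∂(volume.restrict (Ioo 0 T))) atTop (𝓝 0) := by
      have h := ENNReal.Tendsto.const_mul (a := ENNReal.ofReal ν) htail (Or.inr ENNReal.ofReal_ne_top)
      rwa [mul_zero] at h
    refine h1.congr' ?_
    filter_upwards [hsub] with j hj
    rw [hInt j, Measure.restrict_restrict measurableSet_Ioo, inter_eq_self_of_subset_left hj]
  -- Fatou
  have hFatou : ∫⁻ s in Ioo a b, liminf (fun j => H j s) atTop = 0 := by
    refine le_antisymm ?_ zero_le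
    calc ∫⁻ s in Ioo a b, liminf (fun j => H j s) atTop
        ≤ liminf (fun j => ∫⁻ s in Ioo a b, H j s) atTop :=
          lintegral_liminf_le' fun j => (hHm j).aemeasurable
      _ = 0 := hL1.liminf_eq
  have hae0 : ∀ᵐ s ∂(volume.restrict (Ioo a b)), liminf (fun j => H j s) atTop = 0 := by
    have h := (lintegral_eq_zero_iff' (Measurable.liminf fun j => hHm j).aemeasurable).1 hFatou
    filter_upwards [h] with s hs
    simpa using hs
  -- an admissible slice `s₀ ∈ (a, b)`
  have hab0 : volume (Ioo a b) ≠ 0 := by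
    rw [Real.volume_Ioo]; exact (ENNReal.ofReal_pos.2 (by linarith)).ne'
  haveI : (ae (volume.restrict (Ioo a b))).NeBot :=
    ae_neBot.2 (by rwa [Ne, Measure.restrict_eq_zero])
  obtain ⟨s₀, hs₀mem, hs₀⟩ := ((ae_restrict_mem measurableSet_Ioo).and hae0).exists
  refine ⟨s₀, hs₀mem, fun ε hε => ?_⟩
  have hlt : liminf (fun j => H j s₀) atTop < ε := by rw [hs₀]; exact hε
  exact frequently_lt_of_liminf_lt (h := hlt)

/-! ### Smoothness of the vorticity direction away from `ω = 0` -/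

/-- The vorticity direction `ξ = ω/|ω|` is `Cⁿ` at every point where `ω` is `Cⁿ` and non-zero
(the norm is smooth away from the origin of an inner product space). [folklore] -/
theorem contDiffAt_vorticityDirection {n : WithTop ℕ∞}
    {ω : EuclideanSpace ℝ (Fin 3) → EuclideanSpace ℝ (Fin 3)} {x : EuclideanSpace ℝ (Fin 3)}
    (hω : ContDiffAt ℝ n ω x) (hx : ω x ≠ 0) :
    ContDiffAt ℝ n (vorticityDirection ω) x := by
  have h1 : ContDiffAt ℝ n (fun y => ‖ω y‖) x := hω.norm ℝ hx
  have h2 : ContDiffAt ℝ n (fun y => ‖ω y‖⁻¹) x := h1.inv (norm_ne_zero_iff.2 hx)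
  show ContDiffAt ℝ n (fun y => ‖ω y‖⁻¹ • ω y) x
  exact h2.smul hω

/-! ### Dilation inequality for ball integrals on `ℝ³` -/

/-- **Dilated ball integrals.** On `ℝ³`, for `c > 0`, `v`, a ball `B(y₀, r)` whose dilate
`v + c B(y₀, r)` lies in a set `S`, and every `Φ : ℝ³ → [0, ∞]`:
`∫_{B(y₀,r)} Φ(v + c y) dy ≤ (c³)⁻¹ ∫_S Φ(x) dx` (substitution `x = v + c y`, Lebesgue measure
scales by `c³`; the tree's `PoincareBall.lintegral_comp_smul_add`). [folklore] -/
theorem setLIntegral_ball_comp_add_smul_le (Φ : EuclideanSpace ℝ (Fin 3) → ℝ≥0∞) {c : ℝ}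
    (hc : 0 < c) (v y₀ : EuclideanSpace ℝ (Fin 3)) {r : ℝ} {S : Set (EuclideanSpace ℝ (Fin 3))}
    (hS : MeasurableSet S) (hsub : ∀ y ∈ ball y₀ r, v + c • y ∈ S) :
    ∫⁻ y in ball y₀ r, Φ (v + c • y) ≤ ENNReal.ofReal (c ^ 3)⁻¹ * ∫⁻ x in S, Φ x := by
  have h1 : ∫⁻ y in ball y₀ r, Φ (v + c • y) ≤ ∫⁻ y, S.indicator Φ (c • y + v) := by
    rw [← lintegral_indicator measurableSet_ball]
    refine lintegral_mono fun y => ?_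
    by_cases hy : y ∈ ball y₀ r
    · have hmem : c • y + v ∈ S := by rw [add_comm]; exact hsub y hy
      rw [indicator_of_mem hy, indicator_of_mem hmem, add_comm]
    · rw [indicator_of_notMem hy]; exact zero_le
  refine h1.trans (le_of_eq ?_)
  rw [PoincareBall.lintegral_comp_smul_add (S.indicator Φ) hc.ne' v, lintegral_indicator hS,
    finrank_euclideanSpace_fin, abs_of_nonneg (inv_nonneg.2 (pow_nonneg hc.le 3))]

end Summit.NavierStokesRegularity.NavierStokesRegularity.Theorems

end
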